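import Mathlib
import Summits.KontsevichZagierPeriods.Zeta5Search.StairCoverKit
import Summits.KontsevichZagierPeriods.Zeta5Search.CellKitAffine
import HarnessLib

/-!
# ζ(5) search — DENOM-LAW, Rule R2 on the A/B linear family I: ray facts and net-exponent regions (prover-d1 gen 2; MACHINE-GENERATED)

HONEST FRAMING: systematic search; no irrationality claim unless certified.  Cell `pub-zeta5`, track «DENOM-LAW», seat `denom-prover-d1`
(gen 2, ATTEMPT-3; generator `code/gen_abfamily.py` in the seat folder, deposited under `HOME/denom-law/prover-d1/`).  The census's A/B family of
directions `a = (k, k+2, k+2, k+1, k+4, k+8, k+10, k+5)` (A14, A15, A16, A18, B20 = `k` = 14, 15, 16, 18, 20 — the rays where engine-d2's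
RULE R (the `ν+1` cells, `DenomLaw/RuleR.lean`) carries 3.1–6.1 nats/n) has the dual parameter rays
`n·(3t+14; t+6, t+5, t+4, t+3, t+2, t+1, t)`, `t = k − 3`, i.e. the LINEAR RAYS `bLin (t n) (t n + 2n) n` of `CellKitRays` (`b₀ = (3t+14)n`,
`d = (2t+21)n`, pair blocks `(t+i+k)n`).  This file: `b₀`, `d`, polytope membership, the sixteen NET-EXPONENT REGIONS of the ray as
`omega`-checkable level lemmas (lower staircase `[tn+(k−1)n, tn+kn)`, well `[tn+6n, 2tn+8n]`, even centre `2q = (3t+14)n`, upper staircase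
`(2tn+(14−k)n, 2tn+(15−k)n]`), the typed-class constructors and the window facts.  Parts II–V (`RuleRABFamilyCell3…6`) build the class-type
covers of the four unit cells `(t+c)n < p ≤ (t+c+1)n`, `c = 3,4,5,6`, and conclude by THEOREM LB / the Lemma-D bonus.  Valuations of explicit
rationals; every model exponent these feed is `< 1` — no irrationality content; records in print UNMOVED.
-/

open Finset

namespace Summit.KontsevichZagierPeriods.Zeta5Search.RuleRAB

open Summit.KontsevichZagierPeriods.Zeta5Search.ClusterValuation
open Summit.KontsevichZagierPeriods.Zeta5Search.CasoratianValuation (InPolytope shift casoratian)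
open Summit.KontsevichZagierPeriods.Zeta5Search.WedgeDictionary (dOf)
open Summit.KontsevichZagierPeriods.Zeta5Search.CellKit
open Summit.KontsevichZagierPeriods.Zeta5Search.ClassTypeCover

/-! ## §1 The ray `bLin (t n) (t n + 2n) n = n·(3t+14; t+6, …, t)` -/

/-- `b₀ = (3t+14)n` as a natural number. -/
theorem ab_zero_toNat (t n : ℕ) : (bLin (t * n) (t * n + 2 * n) n 0).toNat = 3 * (t * n) + 14 * n := by
  rw [bLin_zero_toNat]; ring

/-- `b₀ = (3t+14)n` as an integer. -/
theorem ab_zero (t n : ℕ) : bLin (t * n) (t * n + 2 * n) n 0 = ((3 * (t * n) + 14 * n : ℕ) : ℤ) := by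
  rw [bLin_zero]; push_cast; ring

/-- `d = 3b₀ − Σ b_j = (2t+21)n`. -/
theorem dOf_ab (t n : ℕ) : dOf (bLin (t * n) (t * n + 2 * n) n) = ((2 * (t * n) + 21 * n : ℕ) : ℤ) := by
  rw [dOf_bLin]; push_cast; ring

/-- The ray lies in the Brown–Zudilin polytope. -/
theorem inPolytope_ab (t n : ℕ) : InPolytope (bLin (t * n) (t * n + 2 * n) n) := inPolytope_bLin (by omega)

/-- Its `e₇`-shift lies in the polytope (`n ≥ 1`). -/
theorem inPolytope_shift_ab (t : ℕ) {n : ℕ} (hn : 1 ≤ n) : InPolytope (shift (bLin (t * n) (t * n + 2 * n) n) 7) := inPolytope_shift_bLin hn (by omega)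

/-! ## §2 Net-exponent regions (`a = tn`, `e = tn + 2n`) -/

section Levels

variable {t n q : ℕ}

/-- Below the blocks: `q < tn`. -/
theorem ne_low (h : q < t * n) : netExp (bLin (t * n) (t * n + 2 * n) n) q = 1 := by
  rw [netExp_bLin_of_ne (by omega), depL_low h]; norm_num

/-- `[tn+0n, tn+1n)`: depth 1. -/
theorem ne_d1 (h : t * n ≤ q ∧ q < t * n + n) : netExp (bLin (t * n) (t * n + 2 * n) n) q = 0 := by
  rw [netExp_bLin_of_ne (by omega), depL_lower (by norm_num : 1 ≤ 1) (by norm_num) (by omega) (by omega)]; norm_num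

/-- `[tn+1n, tn+2n)`: depth 2. -/
theorem ne_d2 (h : t * n + n ≤ q ∧ q < t * n + 2 * n) : netExp (bLin (t * n) (t * n + 2 * n) n) q = -1 := by
  rw [netExp_bLin_of_ne (by omega), depL_lower (by norm_num : 1 ≤ 2) (by norm_num) (by omega) (by omega)]; norm_num

/-- `[tn+2n, tn+3n)`: depth 3. -/
theorem ne_d3 (h : t * n + 2 * n ≤ q ∧ q < t * n + 3 * n) : netExp (bLin (t * n) (t * n + 2 * n) n) q = -2 := by
  rw [netExp_bLin_of_ne (by omega), depL_lower (by norm_num : 1 ≤ 3) (by norm_num) (by omega) (by omega)]; norm_num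

/-- `[tn+3n, tn+4n)`: depth 4. -/
theorem ne_d4 (h : t * n + 3 * n ≤ q ∧ q < t * n + 4 * n) : netExp (bLin (t * n) (t * n + 2 * n) n) q = -3 := by
  rw [netExp_bLin_of_ne (by omega), depL_lower (by norm_num : 1 ≤ 4) (by norm_num) (by omega) (by omega)]; norm_num

/-- `[tn+4n, tn+5n)`: depth 5. -/
theorem ne_d5 (h : t * n + 4 * n ≤ q ∧ q < t * n + 5 * n) : netExp (bLin (t * n) (t * n + 2 * n) n) q = -4 := by
  rw [netExp_bLin_of_ne (by omega), depL_lower (by norm_num : 1 ≤ 5) (by norm_num) (by omega) (by omega)]; norm_num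

/-- `[tn+5n, tn+6n)`: depth 6. -/
theorem ne_d6 (h : t * n + 5 * n ≤ q ∧ q < t * n + 6 * n) : netExp (bLin (t * n) (t * n + 2 * n) n) q = -5 := by
  rw [netExp_bLin_of_ne (by omega), depL_lower (by norm_num : 1 ≤ 6) (by norm_num) (by omega) (by omega)]; norm_num

/-- The well `[tn+6n, 2tn+8n]` off the centre: depth 7. -/
theorem ne_well (h : t * n + 6 * n ≤ q ∧ q ≤ 2 * (t * n) + 8 * n ∧ 2 * q ≠ 3 * (t * n) + 14 * n) : netExp (bLin (t * n) (t * n + 2 * n) n) q = -6 := by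
  rw [netExp_bLin_of_ne (by omega), depL_well (by omega) (by omega)]; norm_num

/-- The even centre `2q = (3t+14)n` (inside the well). -/
theorem ne_cen (h : 2 * q = 3 * (t * n) + 14 * n) : netExp (bLin (t * n) (t * n + 2 * n) n) q = -5 := by
  rw [netExp_bLin_centre (by omega), depL_well (by omega) (by omega)]; norm_num

/-- `(2tn+8n, 2tn+9n]`: depth 6. -/
theorem ne_u6 (h : 2 * (t * n) + 8 * n < q ∧ q ≤ 2 * (t * n) + 9 * n) : netExp (bLin (t * n) (t * n + 2 * n) n) q = -5 := by
  rw [netExp_bLin_of_ne (by omega), depL_upper (by norm_num : 1 ≤ 6) (by norm_num) (by omega) (by omega)]; norm_num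

/-- `(2tn+9n, 2tn+10n]`: depth 5. -/
theorem ne_u5 (h : 2 * (t * n) + 9 * n < q ∧ q ≤ 2 * (t * n) + 10 * n) : netExp (bLin (t * n) (t * n + 2 * n) n) q = -4 := by
  rw [netExp_bLin_of_ne (by omega), depL_upper (by norm_num : 1 ≤ 5) (by norm_num) (by omega) (by omega)]; norm_num

/-- `(2tn+10n, 2tn+11n]`: depth 4. -/
theorem ne_u4 (h : 2 * (t * n) + 10 * n < q ∧ q ≤ 2 * (t * n) + 11 * n) : netExp (bLin (t * n) (t * n + 2 * n) n) q = -3 := by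
  rw [netExp_bLin_of_ne (by omega), depL_upper (by norm_num : 1 ≤ 4) (by norm_num) (by omega) (by omega)]; norm_num

/-- `(2tn+11n, 2tn+12n]`: depth 3. -/
theorem ne_u3 (h : 2 * (t * n) + 11 * n < q ∧ q ≤ 2 * (t * n) + 12 * n) : netExp (bLin (t * n) (t * n + 2 * n) n) q = -2 := by
  rw [netExp_bLin_of_ne (by omega), depL_upper (by norm_num : 1 ≤ 3) (by norm_num) (by omega) (by omega)]; norm_num

/-- `(2tn+12n, 2tn+13n]`: depth 2. -/
theorem ne_u2 (h : 2 * (t * n) + 12 * n < q ∧ q ≤ 2 * (t * n) + 13 * n) : netExp (bLin (t * n) (t * n + 2 * n) n) q = -1 := by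
  rw [netExp_bLin_of_ne (by omega), depL_upper (by norm_num : 1 ≤ 2) (by norm_num) (by omega) (by omega)]; norm_num

/-- `(2tn+13n, 2tn+14n]`: depth 1. -/
theorem ne_u1 (h : 2 * (t * n) + 13 * n < q ∧ q ≤ 2 * (t * n) + 14 * n) : netExp (bLin (t * n) (t * n + 2 * n) n) q = 0 := by
  rw [netExp_bLin_of_ne (by omega), depL_upper (by norm_num : 1 ≤ 1) (by norm_num) (by omega) (by omega)]; norm_num

/-- Above the blocks: `q > 2tn+14n`. -/
theorem ne_high (h : 2 * (t * n) + 14 * n < q) : netExp (bLin (t * n) (t * n + 2 * n) n) q = 1 := by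
  rw [netExp_bLin_of_ne (by omega), depL_high (by omega)]; norm_num

variable {p x : ℕ} [Fact p.Prime]

/-- Typed class on the ray, not self-conjugate. -/
theorem abType_ne (L : ℕ) {T : List ℤ} (hlen : T.length = L + 1) (hx : x < p) (hL : x + L * p ≤ 3 * (t * n) + 14 * n)
    (hL' : 3 * (t * n) + 14 * n < x + L * p + p) (hlev : Levels (bLin (t * n) (t * n + 2 * n) n) x p T)
    (hne : 2 * x + L * p ≠ 3 * (t * n) + 14 * n) : IsType (bLin (t * n) (t * n + 2 * n) n) p x T false :=
  isType_of_ne (by rw [ab_zero]; positivity) L hlen hx (by rw [ab_zero_toNat]; exact hL)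
    (by rw [ab_zero_toNat]; exact hL') hlev (by rw [ab_zero_toNat]; exact hne)

/-- Typed class on the ray, self-conjugate. -/
theorem abType_eq (L : ℕ) {T : List ℤ} (hlen : T.length = L + 1) (hx : x < p) (hL : x + L * p ≤ 3 * (t * n) + 14 * n)
    (hL' : 3 * (t * n) + 14 * n < x + L * p + p) (hlev : Levels (bLin (t * n) (t * n + 2 * n) n) x p T)
    (heq : 2 * x + L * p = 3 * (t * n) + 14 * n) : IsType (bLin (t * n) (t * n + 2 * n) n) p x T true :=
  isType_of_eq (by rw [ab_zero]; positivity) L hlen hx (by rw [ab_zero_toNat]; exact hL)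
    (by rw [ab_zero_toNat]; exact hL') hlev (by rw [ab_zero_toNat]; exact heq)

end Levels

/-! ## §3 Window facts of the cells `(t+c)n < p ≤ (t+c+1)n`, `3 ≤ c ≤ 6` -/

/-- `5 ≤ p`, `p ≤ b₀`, `p ≤ d`, `b₀ + 2 < p²` whenever `tn + 3n < p ≤ tn + 7n`, `n ≥ 1`, `t ≥ 1`. -/
theorem window {t n p : ℕ} (ht : n ≤ t * n) (hn : 1 ≤ n) (hA : t * n + 3 * n < p) (hB : p ≤ t * n + 7 * n) :
    5 ≤ p ∧ (p : ℤ) ≤ bLin (t * n) (t * n + 2 * n) n 0 ∧ (p : ℤ) ≤ dOf (bLin (t * n) (t * n + 2 * n) n) ∧ (bLin (t * n) (t * n + 2 * n) n 0 + 2 : ℤ) < (p : ℤ) ^ 2 := by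
  have hp5 : 5 ≤ p := by omega
  have hsq : 3 * (t * n) + 14 * n + 2 < p * p := by
    have : 5 * p ≤ p * p := Nat.mul_le_mul_right p hp5
    omega
  refine ⟨hp5, ?_, ?_, ?_⟩
  · rw [ab_zero]; exact_mod_cast (show p ≤ 3 * (t * n) + 14 * n by omega)
  · rw [dOf_ab]; exact_mod_cast (show p ≤ 2 * (t * n) + 21 * n by omega)
  · rw [ab_zero]
    have h := hsq
    zify at h
    push_cast
    nlinarith [h]

/-- The same window facts on the top cell `tn + 2n < p ≤ tn + 3n` (`t ≥ 7`). -/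
theorem window_top {t n p : ℕ} (ht : 7 * n ≤ t * n) (_hn : 1 ≤ n) (hA : t * n + 2 * n < p) (hB : p ≤ t * n + 3 * n) :
    5 ≤ p ∧ (p : ℤ) ≤ bLin (t * n) (t * n + 2 * n) n 0 ∧ (p : ℤ) ≤ dOf (bLin (t * n) (t * n + 2 * n) n) ∧ (bLin (t * n) (t * n + 2 * n) n 0 + 2 : ℤ) < (p : ℤ) ^ 2 := by
  have hp5 : 5 ≤ p := by omega
  have hsq : 3 * (t * n) + 14 * n + 2 < p * p := by
    have : 5 * p ≤ p * p := Nat.mul_le_mul_right p hp5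
    omega
  refine ⟨hp5, ?_, ?_, ?_⟩
  · rw [ab_zero]; exact_mod_cast (show p ≤ 3 * (t * n) + 14 * n by omega)
  · rw [dOf_ab]; exact_mod_cast (show p ≤ 2 * (t * n) + 21 * n by omega)
  · rw [ab_zero]
    have h := hsq
    zify at h
    push_cast
    nlinarith [h]

end Summit.KontsevichZagierPeriods.Zeta5Search.RuleRAB
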